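import Summits.AnomalousDissipation.AnomalousDissipation.Theorems.ImpulseGridGridThesisStubLaplacianPairingBound
import Summits.AnomalousDissipation.AnomalousDissipation.Theorems.ImpulseGridGridSignsLawStubAcdcGridAdmissible
import Summits.AnomalousDissipation.AnomalousDissipation.Theorems.ImpulseGridGridSignsLawStubProfileFluxLaw
import Literature.Analysis.FluidPDE.LerayHopfUniformEnergyMomentum

/-!
# AnomalousDissipation / ImpulseGrid — support item `GridThesisOfAcdc`

Route `AnomalousDissipation/ImpulseGrid`, item stmt-AnomalousDissipation-18238 (`GridThesisOfAcdc`,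
support, rank 9): the AC/DC split glue `AcdcFirstMomentLaw → AcdcEnergyNoLeak → GridThesis` of the
deciding crux `GridThesis` (stmt-AnomalousDissipation-1770).  Ported from the crux strategist's
sorry-free workfile `Cruxes/GridThesis/Lines/AcdcSplit.lean` (theorem `gridThesis_of_acdc`), with the
two hypotheses now referred to by their route names.  It is the ASSEMBLY of the typed decomposition of
`GridThesis` into two pieces stated over the EXPLICIT AC/DC grid of the two live lines (crux
`GridThesis`, line `Sketch`, lead stub `stub_dragFamilyForAcdcGrid`; crux `GridSignsLaw`, line
`Sketch`, physics stub `stub_firstMomentLawACDC`):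

* force `f = Φ • G`, `Φ(x) = 1 + 2θ cos 2πx₀` (unit-mass slab profile, AC depth `θ > 0`),
  `G = A [sin 2πm(x₁+x₂) (e₁−e₂) + sin 2πm(x₁−x₂) (e₁+e₂)]` (cellular two-mode Stokes pattern at
  transverse wavenumber `(m, ±m)`, `G ⊥ e₀`, `x₀`-independent), drift `c > 0`;
* `X₁ = AcdcFirstMomentLaw` (a UNIVERSAL SIGN LAW; `∃` parameters `∀` families): for some
  `(m, A, θ, c)` EVERY vanishing-viscosity global Leray–Hopf family with drift data `∫u₀ⱼ = c e₀`,
  per-`j` sup-energy bounds and `meanEnergy ≤ E` has, eventually in `j` and in one generalized limit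
  `Λ`, non-negative DC work `0 ≤ Λ⟨(G,u_j)⟩` and an AC-work floor `κ ≤ Λ⟨((Φ−1)•G,u_j)⟩` — verbatim
  the registered physics stub `stub_firstMomentLawACDC` of the `GridSignsLaw` line;
* `X₂ = AcdcEnergyNoLeak` (EXISTENCE; `∀` parameters `∃` family): for all `(m, A, θ, c)` the force
  admits a vanishing-viscosity global Leray–Hopf family with drift data, ν-uniformly bounded mean
  energy and no Leray–Hopf leakage in the mean — the AC/DC specialisation of the route crux
  `BoundedEnergyNoLeakGrid` (stmt-14350) minus its per-`j` sup-energy clause (derived here).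

`gridThesisOfAcdc_proof : GridThesisOfAcdc`, i.e. `X₁ → X₂ → GridThesis` with `X₁, X₂` the route's
split children of `GridThesis`.  Proof: parameters from `X₁`; the fifteen design
clauses of the explicit grid (`stub_acdcGridAdmissible`, with the sawtooth `Ψ = (θ/π) sin 2πx₀`);
the family from `X₂` at those parameters; per-`j` sup-in-time energy bounds from the Leray–Hopf
energy inequality with a mean-zero steady force at `ν_j > 0`
(`IsGlobalLerayHopf.exists_forall_integral_norm_sq_le_of_hasZeroMean`, FMRT (3.2)); the law applied
to the family gives `κ, Λ, J₁`; conjunct (a) of `GridThesis` is the DC sign; conjunct (b) is the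
PROFILE FLUX LAW at the weight `ρ = Ψ` (`stub_profileFluxLaw`: the `x₀`-moment of the mean momentum
balance, `c·Λ⟨(∂₀Ψ•G,u)⟩ + Λ⟨∫⟪w,(w·∇)(ΨG)⟫⟩ + νΛ⟨(u,Δ(ΨG))⟩ + ∫ΦΨ‖G‖² = 0`, `∂₀Ψ = Φ − 1`,
`∫ΦΨ‖G‖² = 0`) together with the ν-uniform viscous remainder bound
`|Λ⟨(u_j, Δ(ΨG))⟩| ≤ ‖Δ(ΨG)‖_∞ (1 + E)/2` (`stub_laplacianPairingBound`) and a threshold `J₂` with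
`ν_j (|R|+1) < cκ/2` beyond it, so that `Λ⟨∫⟪w_j,(w_j·∇)(ΨG)⟫⟩ ≤ −cκ + cκ/2 = −η`, `η := cκ/2`;
finally the family is reindexed by `j ↦ j + max J₁ J₂` (`Filter.tendsto_add_atTop_nat`).

Neither hypothesis is a zeroth-law witness on its own: `X₁` has no existence content (its cheap
probe towards `GridThesis` / the summit fails for want of a family), `X₂` has no sign / dissipation
floor (its probe fails for want of `ε > 0`); the assembly is where the Navier–Stokes content (design
calculus, momentum-moment identity, viscous remainder, Leray–Hopf energy bound) is spent.

References: C. Foias, O. Manley, R. Rosa, R. Temam, *Navier–Stokes Equations and Turbulence*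
(2001), Ch. II (3.2), Ch. IV §3.1; C. R. Doering, C. Foias, J. Fluid Mech. 467 (2002) §2.
-/

noncomputable section

open MeasureTheory Set Filter Topology
open scoped InnerProductSpace RealInnerProductSpace

-- `Summit.<Summit>.<Problem>` is the tree's mandated summit-side namespace (CONVENTIONS §2); for this
-- single-conjunct summit the two coincide, so the duplicate is deliberate.
set_option linter.dupNamespace false

namespace Summit.AnomalousDissipation.AnomalousDissipation.Theorems

open Literature.Analysis.FunctionSpaces Literature.Analysis.FunctionSpaces.Torus
open Literature.Analysis.FluidPDE Literature.Analysis.FluidPDE.Torus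
open Summit.AnomalousDissipation.AnomalousDissipation.Theses.ImpulseGrid

/-- Settles stmt-AnomalousDissipation-18238 (support item `GridThesisOfAcdc` of route ImpulseGrid):
**the AC/DC split of `GridThesis`**, `AcdcFirstMomentLaw → AcdcEnergyNoLeak → GridThesis`.
Parameters `(m, A, θ, c)` from the law, the fifteen design clauses of the explicit grid from
`stub_acdcGridAdmissible` (sawtooth `Ψ = (θ/π) sin 2πx₀`), the family from the existence hypothesis at
those parameters, per-`j` sup-energy bounds from the Leray–Hopf class
(`IsGlobalLerayHopf.exists_forall_integral_norm_sq_le_of_hasZeroMean`), `(κ, Λ, J₁)` from the law,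
conjunct (b) from the profile flux law at `ρ = Ψ` (`stub_profileFluxLaw`) with the ν-uniform Laplacian
pairing bound (`stub_laplacianPairingBound`) and `η := cκ/2`, then the tail shift `j ↦ j + max J₁ J₂`.
[folklore] -/
theorem gridThesisOfAcdc_proof : GridThesisOfAcdc := by
  unfold GridThesisOfAcdc
  intro hLaw hEx
  obtain ⟨m, A, θ, c, hm, hA, hθ, hc, hlaw⟩ := hLaw
  -- the explicit design
  set Φ : UnitAddTorus (Fin 3) → ℝ :=
    fun x => 1 + 2 * θ * (UnitAddTorus.mFourier (Pi.single (0 : Fin 3) (1 : ℤ)) x).re with hΦdef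
  set Ψ : UnitAddTorus (Fin 3) → ℝ :=
    fun x => θ / Real.pi * (UnitAddTorus.mFourier (Pi.single (0 : Fin 3) (1 : ℤ)) x).im with hΨdef
  set G : UnitAddTorus (Fin 3) → EuclideanSpace ℝ (Fin 3) := fun x =>
    A • (stokesMode ![(0 : ℤ), (m : ℤ), (m : ℤ)]
        (EuclideanSpace.single (1 : Fin 3) (1 : ℝ) - EuclideanSpace.single (2 : Fin 3) (1 : ℝ)) false x +
      stokesMode ![(0 : ℤ), (m : ℤ), -(m : ℤ)]
        (EuclideanSpace.single (1 : Fin 3) (1 : ℝ) + EuclideanSpace.single (2 : Fin 3) (1 : ℝ)) false x)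
    with hGdef
  -- the fifteen design clauses of the explicit grid
  obtain ⟨hΦ, hΨ, hG, -, -, hΨinv, hGinv, hG0, hGdiv, hΨderiv, hΦΨG, hfs, hfd, hfm, -⟩ :=
    stub_acdcGridAdmissible m A θ c Φ Ψ G hΦdef hΨdef hGdef hm hA hθ hc
  -- the bounded-energy no-leak drift family at these parameters
  obtain ⟨ν, u₀, u, hν, hν0, hu, hdrift, ⟨E, hE⟩, hNL⟩ := hEx m A θ c hm hA hθ hc Φ G hΦdef hGdef
  -- per-`j` sup-in-time kinetic-energy bounds (Leray–Hopf, mean-zero steady force, `ν_j > 0`)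
  have hsup : ∀ j, ∃ C₀ : ℝ, ∀ t : ℝ, 0 ≤ t → kineticEnergy (u j t) ≤ C₀ := by
    intro j
    obtain ⟨R₀, hR₀⟩ :=
      (hu j).exists_forall_integral_norm_sq_le_of_hasZeroMean (hν j) (hfs.memLp 2) hfm
    refine ⟨2⁻¹ * R₀, fun t ht => ?_⟩
    unfold kineticEnergy
    exact mul_le_mul_of_nonneg_left (hR₀ t ht) (by norm_num)
  -- the law applied to the family
  obtain ⟨κ, hκ, Λ, J₁, hJ₁⟩ := hlaw Φ G hΦdef hGdef ν u₀ u E hν hν0 hu hsup hdrift hE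
  -- the sup norm of `Δ(Ψ • G)` and the uniform size `R` of the viscous remainder
  have hΨG : IsSmooth (fun x => Ψ x • G x) := hΨ.smul' hG
  obtain ⟨M, hM0, hM⟩ := exists_nonneg_forall_norm_le_of_continuous hΨG.laplacian.continuous
  set R : ℝ := M * (1 + E) / 2 with hR
  have hR1 : 0 < |R| + 1 := by positivity
  have hδ : 0 < c * κ / (2 * (|R| + 1)) := by positivity
  obtain ⟨J₂, hJ₂⟩ := eventually_atTop.1 ((tendsto_order.1 hν0).2 _ hδ)
  -- the two grid sign conditions beyond `J := max J₁ J₂`, with `η := cκ/2`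
  have key : ∀ j, max J₁ J₂ ≤ j →
      0 ≤ Λ.longTimeAvg (fun t => ∫ x, ⟪G x, u j t x⟫) ∧
      Λ.longTimeAvg (fun t => ∫ x, ⟪u j t x - c • EuclideanSpace.single 0 1,
        convect (fun y => u j t y - c • EuclideanSpace.single 0 1) (fun y => Ψ y • G y) x⟫) ≤
        -(c * κ / 2) := by
    intro j hj
    obtain ⟨ha, hb⟩ := hJ₁ j ((le_max_left _ _).trans hj)
    have hνj : ν j < c * κ / (2 * (|R| + 1)) := hJ₂ j ((le_max_right _ _).trans hj)
    refine ⟨ha, ?_⟩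
    -- the profile flux law at `ρ = Ψ` and the Laplacian pairing bound at the member `j`
    have hid := stub_profileFluxLaw Λ (ν j) c Φ Ψ G (u₀ j) (u j) (hν j) hΦ hΨ hG hΨinv hGinv hG0
      hGdiv (hu j) (hsup j)
    have hbd := stub_laplacianPairingBound Λ (ν j) M (fun x => Φ x • G x) (fun y => Ψ y • G y)
      (u₀ j) (u j) hΨG hM (hu j) (hsup j)
    -- `∂₀Ψ • G = (Φ - 1) • G` under the binders
    have hAC : (fun t => ∫ x, ⟪partialDeriv 0 Ψ x • G x, u j t x⟫) =
        fun t => ∫ x, ⟪(Φ x - 1) • G x, u j t x⟫ := by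
      funext t
      refine integral_congr_ae (ae_of_all _ fun x => ?_)
      show ⟪partialDeriv 0 Ψ x • G x, u j t x⟫ = ⟪(Φ x - 1) • G x, u j t x⟫
      rw [hΨderiv x]
    rw [hAC, hΦΨG, add_zero] at hid
    -- abbreviations
    set D : ℝ := Λ.longTimeAvg (fun t => ∫ x, ⟪(Φ x - 1) • G x, u j t x⟫) with hD
    set L : ℝ := Λ.longTimeAvg (fun t => ∫ x, ⟪u j t x, laplacian (fun y => Ψ y • G y) x⟫) with hL
    set B : ℝ := Λ.longTimeAvg (fun t => ∫ x, ⟪u j t x - c • EuclideanSpace.single 0 1,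
      convect (fun y => u j t y - c • EuclideanSpace.single 0 1) (fun y => Ψ y • G y) x⟫) with hB
    -- `B = -c D - ν_j L`
    have hBeq : B = -(c * D) - ν j * L := by linarith
    -- the viscous remainder: `|L| ≤ M (1 + meanEnergy)/2 ≤ R`, so `ν_j L ≥ -ν_j R ≥ -cκ/2`
    have hmono : M * (1 + meanEnergy (u j)) / 2 ≤ R := by
      have : M * (1 + meanEnergy (u j)) ≤ M * (1 + E) :=
        mul_le_mul_of_nonneg_left (by linarith [hE j]) hM0
      rw [hR]; linarith
    have hLR : -R ≤ L := by
      have := (abs_le.1 hbd).1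
      linarith
    have hRabs : R ≤ |R| + 1 := (le_abs_self R).trans (le_add_of_nonneg_right zero_le_one)
    have h1 : -(ν j * R) ≤ ν j * L := by nlinarith [hν j]
    have h2 : ν j * R ≤ ν j * (|R| + 1) := mul_le_mul_of_nonneg_left hRabs (hν j).le
    have h3 : ν j * (|R| + 1) ≤ c * κ / (2 * (|R| + 1)) * (|R| + 1) :=
      mul_le_mul_of_nonneg_right hνj.le hR1.le
    have h4 : c * κ / (2 * (|R| + 1)) * (|R| + 1) = c * κ / 2 := by
      field_simp
    have hcD : c * κ ≤ c * D := mul_le_mul_of_nonneg_left hb hc.le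
    rw [hBeq]
    linarith
  -- assemble `GridThesis` on the reindexed family `j ↦ j + J`
  have hη : 0 < c * κ / 2 := by positivity
  refine ⟨Φ, Ψ, G, c, c * κ / 2, Λ, hΦ, hΨ, hG, hΨinv, hGinv, hG0, hGdiv, hΨderiv, hΦΨG, hfs, hfd,
    hfm, hc, hη, fun j => ν (j + max J₁ J₂), fun j => u₀ (j + max J₁ J₂),
    fun j => u (j + max J₁ J₂), fun j => hν _, hν0.comp (tendsto_add_atTop_nat (max J₁ J₂)),
    fun j => hu _, fun j => hsup _, fun j => hdrift _, ⟨E, fun j => hE _⟩, fun j => hNL _,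
    fun j => (key (j + max J₁ J₂) (Nat.le_add_left _ _)).1,
    fun j => (key (j + max J₁ J₂) (Nat.le_add_left _ _)).2⟩

end Summit.AnomalousDissipation.AnomalousDissipation.Theorems

end
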